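import Literature.AlgebraicGeometry.Frobenioids.PadicKummerIsoOfFunctor
import Literature.AlgebraicGeometry.Frobenioids.UnitWiseFrobeniusZetaStrict
import Literature.AlgebraicGeometry.Frobenioids.PadicKummerRemark242Witness
import Literature.AlgebraicGeometry.Frobenioids.PadicFrobenioidRmk121Holds
import HarnessLib

/-!
# Frobenioids II, Remark 2.4.2 AT THE FUNCTOR LEVEL: the unit-wise Frobenius self-equivalence `Ψ_ζ` of an
# absolutely primitive `p`-adic Frobenioid induces, on the Definition 2.2 context of every object, an
# automorphism acting on `F_N(A)` by "raising to the `ζ`-th power" — incompatible with `F_N(A) ⥲ ℤ/Nℤ`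

S. Mochizuki, *The geometry of Frobenioids II: poly-Frobenioids*, Kyushu J. Math. **62** (2008) 401–460,
§2, Remark 2.4.2, kurims p. 22 l. 30–36 [cite: MochizukiFrdII2008, Rmk 2.4.2 p.22]: "Indeed, when the `Φᵢ`
are absolutely primitive [cf. Remark 1.2.1], an example of such a `Ψ` is provided by the *unit-wise
Frobenius functor* of [Mzk5], Proposition 2.9, (ii), which acts on `F_N(Aᵢ)` [relative to the natural
isomorphisms `F_N(Aᵢ) ⥲ ℤ/Nℤ`] by 'raising to the `ζ`-th power' [cf. 'the compatibility with the
reciprocity map' asserted in Theorem 2.4, (i); [Mzk5], Proposition 2.9, (ii), (a), (c)]."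

PROOF-ONLY file (abc-iut cell, layer L1, seat abc-iut-w5-d248 gen 3; SUBDAG-FrdII-Thm24 row L26, sub-piece
(α-ζ) of GAP row G-L1t7-α named by abc-iut-L1-t7 gen 4). The Remark is now a theorem about the `p`-adic
Frobenioid CATEGORY `C = d.frobenioid` itself, no longer a statement about an abstract context automorphism:
* the functor is `Ψ := PreFrobenioid.UnitWiseFrobeniusZeta.psiStrict …` — [FrdI] Prop. 2.9 (ii)'s
  unit-wise Frobenius functor in strict normal form (`UnitWiseFrobeniusZetaStrict.lean`: `Ψ(A) = A`, `Ψ`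
  lies over `C → F_Φ` on the nose, `Ψ(u) = u^ζ` on `O^×(A)`), an equivalence for `ζ` of co-prime type;
  its existence inputs for a `p`-adic Frobenioid with absolutely primitive `Φ` are Remark 1.2.1's
  (`exists_unitWiseFrobenius_incompatible` discharges them from abc-iut-L1-t4 / -d10 / -w4-d108 theorems);
* the context isomorphism is abc-iut-L1-t7's `GaloisChart.isoOfFunctor Ψ c c …` (row (α), file D4): the
  isomorphism of the Definition 2.2 context `ofChart c H hH` of the OBJECT `A` with itself INDUCED BY THE
  FUNCTOR `Ψ` (`isoC := Ψ` on `Aut_C(A)`, `isoO := Ψ` on `O^▷(A)`, `isoE` the induced map of `Gal(L/K)`, here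
  the identity, over the identity of `G_K`); its three printed inputs are DISCHARGED for `Ψ`: "`Ψ` preserves
  `O^⊳(−)`" (`hO`: `Ψ` lies over `F_Φ` literally), the outer isomorphism (`isoG := 1`, `houter`: `Ψ` is the
  identity on `Base`), `map_H`;
* MECHANISM (abc-iut-w5-d248 gen 2, `PadicKummerRemark242Witness.lean`): a context automorphism that is the
  identity on `Aut_E(A_E)` and the `n`-th power on `μ_N(A)` acts on `F_N(A)` by `n`
  (`Def22Context.Iso.isoFN_eq_nsmul`);
* hence (this file) for `N = l^k`: `Ψ` acts on `μ_N(A) ⊆ O^×(A)` by the `ζ(l)`-th power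
  (`muIso_isoOfFunctor_psiStrict`, from `psiStrict_map_unit_of_pow_eq_one`), so "acts on `F_N(A)` relative
  to the natural isomorphisms `F_N(A) ⥲ ℤ/Nℤ` by raising to the `ζ`-th power" for EVERY invariant datum
  (`actsOnFNByPower_unitWiseFrobenius`), is `InvariantIncompatible` as soon as `ζ(l) ≢ 1 (mod N)`
  (`invariantIncompatible_unitWiseFrobenius`) — so the conclusion of Theorem 2.4 (ii) FAILS for this `Ψ`
  (`not_thm24ii_conclusion_unitWiseFrobenius`), while Theorem 2.4 (i) HOLDS for it (abc-iut-L1-t7's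
  `thm24i_ofChart`, `thm24i_unitWiseFrobenius`).
Honest framing: [FrdI]/[FrdII] are refereed prerequisites of IUT; nothing here concerns [IUTchIII] Cor. 3.12;
no statement of either paper is restated or strengthened (the predicates are abc-iut-L1-t7's, the functor
abc-iut-L6-t9's, the mechanism abc-iut-w5-d248's).
-/

noncomputable section

namespace Literature.AlgebraicGeometry.Frobenioids

namespace PadicFrd.Datum.GaloisChart

open CategoryTheory Opposite Function Field IntermediateField Kummer
open Literature.NumberTheory.GaloisRepresentations
open PreFrobenioid PreFrobenioid.UnitWiseFrobeniusZeta PadicKummer PadicKummer.Def22Context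

/-! ### The unit-wise Frobenius functor of a `p`-adic Frobenioid and a Galois chart -/

section General

variable {D : Type} [SmallCategory D] {p : ℕ} [Fact p.Prime] {d : Datum D p}
  (hF : IsFrobenioid d.structureFunctor) (τ : CharacteristicSplitting d.structureFunctor)
  (hnorm : IsOfType (IsFrobeniusNormalized d.structureFunctor))
  (hbt : IsOfType (IsBaseTrivial d.structureFunctor)) (histr : IsOfIsotropicType d.structureFunctor)
  (hup : IsOfUnitProfiniteType d.structureFunctor)
  {P : Presection d.frobenioid} {Fr : ℕ+ →* End P.ι} (hpair : IsBaseFrobeniusPair d.structureFunctor P Fr)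
  (ζ : Nat.Primes → ℕ+) (hζ : IsOfCoprimeType ζ)
  {A : d.frobenioid} {K : Type} [Field K] {L : IntermediateField K (AlgebraicClosure K)}
  (c : GaloisChart d A K L)

include hζ in
/-- `Ψ_ζ` is full (an equivalence for `ζ` of co-prime type, [FrdI] Prop. 2.9 (ii)(d)).
[cite: MochizukiFrdI2008, Prop. 2.9(ii) p.53] -/
theorem full_psiStrict : (psiStrict hF τ hnorm hbt histr hup hpair ζ).Full :=
  haveI := psiStrict_isEquivalence hF τ hnorm hbt histr hup hpair ζ hζ
  inferInstance

include hζ in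
/-- `Ψ_ζ` is faithful (an equivalence for `ζ` of co-prime type, [FrdI] Prop. 2.9 (ii)(d)).
[cite: MochizukiFrdI2008, Prop. 2.9(ii) p.53] -/
theorem faithful_psiStrict : (psiStrict hF τ hnorm hbt histr hup hpair ζ).Faithful :=
  haveI := psiStrict_isEquivalence hF τ hnorm hbt histr hup hpair ζ hζ
  inferInstance

/-- **"`Ψ` preserves `O^⊳(−)`"** (the input `hO` of the context isomorphism, FrdII Thm. 2.4 proof p. 20) holds
for `Ψ_ζ` LITERALLY: `Ψ_ζ` lies over `C → F_Φ` on the nose. [cite: MochizukiFrdII2008, Thm 2.4 (i) p.20] -/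
theorem hO_psiStrict (f : A ⟶ A) :
    f ∈ PreFrobenioid.endSubmonoid d.structureFunctor A ↔
      (psiStrict hF τ hnorm hbt histr hup hpair ζ).map f ∈
        PreFrobenioid.endSubmonoid d.structureFunctor ((psiStrict hF τ hnorm hbt histr hup hpair ζ).obj A) :=
  mem_endSubmonoid_psiStrict_iff hF τ hnorm hbt histr hup hpair ζ f

/-- `Ψ_ζ` is the identity on `Base`: `Base(Ψ_ζ φ) = Base(φ)` in `D`. [cite: MochizukiFrdI2008, Prop. 2.9(ii) p.55] -/
theorem baseMap_psiStrict {B B' : d.frobenioid} (φ : B ⟶ B') :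
    ModelFrobenioid.baseMap ((psiStrict hF τ hnorm hbt histr hup hpair ζ).map φ) = ModelFrobenioid.baseMap φ :=
  base_psiStrict hF τ hnorm hbt histr hup hpair ζ φ

/-- `Ψ_ζ` is the identity on `A₀ := ` the image in `D₀`: `(Ψ_ζ φ)₀ = φ₀`. [cite: MochizukiFrdII2008, Thm 1.2 (ii) p.9] -/
theorem toBaseZero_map_psiStrict {B B' : d.frobenioid} (φ : B ⟶ B') :
    d.toBaseZero.map ((psiStrict hF τ hnorm hbt histr hup hpair ζ).map φ) = d.toBaseZero.map φ := by
  show d.base.map (ModelFrobenioid.baseMap _) = d.base.map (ModelFrobenioid.baseMap φ)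
  rw [baseMap_psiStrict]

/-- `Ψ_ζ` does not move the image of an automorphism in `Aut_E(A_E) = Gal(L/K)`: `res (Ψ_ζ α) = res α`.
[cite: MochizukiFrdII2008, Thm 2.4 (i) p.19] -/
theorem res_mapIso_psiStrict (α : Aut A) :
    c.res ((psiStrict hF τ hnorm hbt histr hup hpair ζ).mapIso α) = c.res α := by
  apply AlgEquiv.ext
  intro y
  obtain ⟨x, rfl⟩ := c.χ.surjective y
  apply Subtype.ext
  rw [c.res_apply, c.res_apply, Functor.mapIso_inv, toBaseZero_map_psiStrict]

/-- The isomorphism `Gal(L/K) ⥲ Gal(L/K)` induced by `Ψ_ζ` (abc-iut-L1-t7's `galEquiv`) is the identity.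
[cite: MochizukiFrdII2008, Thm 2.4 (i) p.19] -/
theorem galEquiv_psiStrict
    (hker : ∀ α : Aut A, c.res α = 1 ↔ α.hom ∈ PreFrobenioid.endSubmonoid d.structureFunctor A)
    (σ : L ≃ₐ[K] L) :
    haveI := full_psiStrict hF τ hnorm hbt histr hup hpair ζ hζ
    haveI := faithful_psiStrict hF τ hnorm hbt histr hup hpair ζ hζ
    galEquiv (psiStrict hF τ hnorm hbt histr hup hpair ζ) c c (hO_psiStrict hF τ hnorm hbt histr hup hpair ζ)
      hker hker σ = σ := by
  rw [galEquiv_apply, autEquiv_apply, res_mapIso_psiStrict, c.res_lift]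

/-- The outer-isomorphism input `houter` of the context isomorphism holds for `Ψ_ζ` with `isoG := 1`:
`Ψ_ζ` lies over the identity of `G_K`. [cite: MochizukiFrdII2008, Thm 2.4 (i) p.19] -/
theorem houter_psiStrict [Normal K L]
    (hker : ∀ α : Aut A, c.res α = 1 ↔ α.hom ∈ PreFrobenioid.endSubmonoid d.structureFunctor A)
    (g : absoluteGaloisGroup K) :
    haveI := full_psiStrict hF τ hnorm hbt histr hup hpair ζ hζ
    haveI := faithful_psiStrict hF τ hnorm hbt histr hup hpair ζ hζ
    resGal L (ContinuousMulEquiv.refl (absoluteGaloisGroup K) g) =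
      galEquiv (psiStrict hF τ hnorm hbt histr hup hpair ζ) c c (hO_psiStrict hF τ hnorm hbt histr hup hpair ζ)
        hker hker (resGal L g) := by
  rw [galEquiv_psiStrict hF τ hnorm hbt histr hup hpair ζ hζ c hker]
  rfl

/-- `map_H` for `isoG := 1`. [cite: MochizukiFrdII2008, Thm 2.4 (i) p.19] -/
theorem map_H_refl (H : Subgroup (absoluteGaloisGroup K)) :
    H.map (ContinuousMulEquiv.refl (absoluteGaloisGroup K)).toMulEquiv.toMonoidHom = H := by
  ext g
  constructor
  · rintro ⟨h, hh, rfl⟩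
    exact hh
  · intro hg
    exact ⟨g, hg, rfl⟩

/-! ### `Ψ_ζ` on the torsion of `O^▷(A)` -/

/-- A root of unity `ζ₀ ∈ μ_N(A) ⊆ O^▷(A)` as an element of `O^×(A) ⊆ Aut_C(A)` (`unitOf`).
[cite: MochizukiFrdII2008, Def 2.1 (i) p.16] -/
theorem isUnit_val_mu (N : ℕ) (ζ₀ : Mu N (ObjMonoid d A)) :
    IsUnit (show ↥(PreFrobenioid.endSubmonoid d.structureFunctor A) from (ζ₀.val : ObjMonoid d A)) :=
  ζ₀.val.isUnit

/-- The underlying endomorphism of `ζ₀ ∈ μ_N(A)` is that of the unit `unitOf`. [cite: MochizukiFrdII2008, Def 2.1 (i) p.16] -/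
theorem hom_unitOf_mu (N : ℕ) (ζ₀ : Mu N (ObjMonoid d A)) :
    (unitOf (isUnit_val_mu N ζ₀)).1.hom = (ζ₀.val : ObjMonoid d A).hom := by
  rw [← unitsToEnd_val, unitsToEnd_unitOf]
  rfl

/-- Powers: the endomorphism of `unitOf(ζ₀)^m` is that of `ζ₀^m`. [cite: MochizukiFrdII2008, Def 2.1 (i) p.16] -/
theorem hom_unitOf_mu_pow (N : ℕ) (ζ₀ : Mu N (ObjMonoid d A)) (m : ℕ) :
    ((unitOf (isUnit_val_mu N ζ₀) ^ m : ↥(unitsSubgroup d.structureFunctor A)) : Aut A).hom =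
      ((ζ₀ ^ m).val : ObjMonoid d A).hom := by
  rw [← unitsToEnd_val, map_pow, unitsToEnd_unitOf, Mu.val_pow, Units.val_pow_eq_pow_val]
  rfl

/-- `unitOf(ζ₀)^N = 1` for `ζ₀ ∈ μ_N(A)`. [cite: MochizukiFrdII2008, Def 2.1 (i) p.16] -/
theorem unitOf_mu_pow_eq_one (N : ℕ) (ζ₀ : Mu N (ObjMonoid d A)) :
    (unitOf (isUnit_val_mu N ζ₀) ^ N : ↥(unitsSubgroup d.structureFunctor A)) = 1 := by
  apply unitsToEnd_injective (F := d.structureFunctor) A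
  rw [map_pow, unitsToEnd_unitOf, map_one]
  have h : (ζ₀.val : ObjMonoid d A) ^ N = 1 := by
    rw [← Units.val_pow_eq_pow_val, (mem_rootsOfUnity N ζ₀.val).mp ζ₀.val_mem, Units.val_one]
  exact h

/-- **`Ψ_ζ` raises `μ_{l^k}(A)` to the `ζ(l)`-th power** (Prop. 2.9 (ii)(c) on the `l`-power torsion of
`O^×(A)`): for `ζ₀ ∈ μ_{l^k}(A)`, `Ψ_ζ(ζ₀) = ζ₀^{ζ(l)}` as endomorphisms of `A`.
[cite: MochizukiFrdI2008, Prop. 2.9(ii) p.53] -/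
theorem psiStrict_map_mu (l : Nat.Primes) (k : ℕ) (ζ₀ : Mu ((l : ℕ) ^ k) (ObjMonoid d A)) :
    (psiStrict hF τ hnorm hbt histr hup hpair ζ).map (ζ₀.val : ObjMonoid d A).hom =
      ((ζ₀ ^ ((ζ l : ℕ+) : ℕ)).val : ObjMonoid d A).hom := by
  rw [← hom_unitOf_mu, psiStrict_map_unit_of_pow_eq_one hF τ hnorm hbt histr hup hpair ζ l
    (unitOf (isUnit_val_mu _ ζ₀)) (unitOf_mu_pow_eq_one _ ζ₀), hom_unitOf_mu_pow]

end General

/-! ### Remark 2.4.2 for the functor `Ψ_ζ` -/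

section Rmk242

variable {D : Type} [SmallCategory D] {p : ℕ} [Fact p.Prime] {d : Datum D p}
  (hF : IsFrobenioid d.structureFunctor) (τ : CharacteristicSplitting d.structureFunctor)
  (hnorm : IsOfType (IsFrobeniusNormalized d.structureFunctor))
  (hbt : IsOfType (IsBaseTrivial d.structureFunctor)) (histr : IsOfIsotropicType d.structureFunctor)
  (hup : IsOfUnitProfiniteType d.structureFunctor)
  {P : Presection d.frobenioid} {Fr : ℕ+ →* End P.ι} (hpair : IsBaseFrobeniusPair d.structureFunctor P Fr)
  (ζ : Nat.Primes → ℕ+) (hζ : IsOfCoprimeType ζ)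
  {A : d.frobenioid} {K : Type} [Field K] {L : IntermediateField K (AlgebraicClosure K)}
  [Normal K L] [FiniteDimensional K L] (c : GaloisChart d A K L)
  (hker : ∀ α : Aut A, c.res α = 1 ↔ α.hom ∈ PreFrobenioid.endSubmonoid d.structureFunctor A)
  (H : Subgroup (absoluteGaloisGroup K)) [H.Normal] (hH : IsOpen (H : Set (absoluteGaloisGroup K)))

/-- **The automorphism of the Definition 2.2 context of `A` INDUCED BY THE FUNCTOR `Ψ_ζ`** (abc-iut-L1-t7's
`isoOfFunctor` for `F := Ψ_ζ`, both charts `c`, over the identity of `G_K`) is the identity on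
`Aut_E(A_E) = Gal(L/K)`. [cite: MochizukiFrdII2008, Rmk 2.4.2 p.22] -/
theorem isoE_isoOfFunctor_psiStrict (σ : L ≃ₐ[K] L) :
    haveI := full_psiStrict hF τ hnorm hbt histr hup hpair ζ hζ
    haveI := faithful_psiStrict hF τ hnorm hbt histr hup hpair ζ hζ
    (isoOfFunctor (psiStrict hF τ hnorm hbt histr hup hpair ζ) c c (hO_psiStrict hF τ hnorm hbt histr hup hpair ζ)
      hker hker H hH H hH (ContinuousMulEquiv.refl _)
      (houter_psiStrict hF τ hnorm hbt histr hup hpair ζ hζ c hker) (map_H_refl H) Iff.rfl).isoE σ = σ :=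
  galEquiv_psiStrict hF τ hnorm hbt histr hup hpair ζ hζ c hker σ

/-- **`Ψ_ζ` acts on `μ_N(A)` by the `ζ`-th power** (`N = l^k`: by `ζ(l)`), through the context automorphism
it induces. [cite: MochizukiFrdII2008, Rmk 2.4.2 p.22] -/
theorem muIso_isoOfFunctor_psiStrict (l : Nat.Primes) (k : ℕ) (ζ₀ : Mu ((l : ℕ) ^ k) (ofChart c H hH).O) :
    haveI := full_psiStrict hF τ hnorm hbt histr hup hpair ζ hζ
    haveI := faithful_psiStrict hF τ hnorm hbt histr hup hpair ζ hζ
    (isoOfFunctor (psiStrict hF τ hnorm hbt histr hup hpair ζ) c c (hO_psiStrict hF τ hnorm hbt histr hup hpair ζ)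
      hker hker H hH H hH (ContinuousMulEquiv.refl _)
      (houter_psiStrict hF τ hnorm hbt histr hup hpair ζ hζ c hker) (map_H_refl H) Iff.rfl).muIso
        ((l : ℕ) ^ k) ζ₀ = ζ₀ ^ ((ζ l : ℕ+) : ℕ) := by
  apply Mu.ext
  apply Units.ext
  rw [Def22Context.Iso.coe_val_muIso]
  apply ObjMonoid.ext
  change ((psiStrict hF τ hnorm hbt histr hup hpair ζ).map (ζ₀.val : ObjMonoid d A).hom) = _
  exact psiStrict_map_mu hF τ hnorm hbt histr hup hpair ζ l k ζ₀

/-- **Remark 2.4.2 — "acts on `F_N(Aᵢ)` [relative to the natural isomorphisms `F_N(Aᵢ) ⥲ ℤ/Nℤ`] by raising to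
the `ζ`-th power"**: for `N = l^k`, the isomorphism `F_N(A) ⥲ F_N(A)` of Theorem 2.4 (i) induced by the
unit-wise Frobenius functor `Ψ_ζ` is multiplication by `ζ(l)` relative to EVERY invariant datum.
[cite: MochizukiFrdII2008, Rmk 2.4.2 p.22] -/
theorem actsOnFNByPower_unitWiseFrobenius (l : Nat.Primes) (k : ℕ)
    (inv : FNInvariant (ofChart c H hH) ((l : ℕ) ^ k)) :
    haveI := full_psiStrict hF τ hnorm hbt histr hup hpair ζ hζ
    haveI := faithful_psiStrict hF τ hnorm hbt histr hup hpair ζ hζ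
    ActsOnFNByPower (ofChart c H hH) (ofChart c H hH) ((l : ℕ) ^ k)
      ((isoOfFunctor (psiStrict hF τ hnorm hbt histr hup hpair ζ) c c
        (hO_psiStrict hF τ hnorm hbt histr hup hpair ζ) hker hker H hH H hH (ContinuousMulEquiv.refl _)
        (houter_psiStrict hF τ hnorm hbt histr hup hpair ζ hζ c hker) (map_H_refl H) Iff.rfl).thm24Data
          ((l : ℕ) ^ k))
      inv inv (((ζ l : ℕ+) : ℕ) : ZMod ((l : ℕ) ^ k)) :=
  Def22Context.Iso.actsOnFNByPower_of_muIso_eq_pow _ _ _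
    (isoE_isoOfFunctor_psiStrict hF τ hnorm hbt histr hup hpair ζ hζ c hker H hH)
    (muIso_isoOfFunctor_psiStrict hF τ hnorm hbt histr hup hpair ζ hζ c hker H hH l k) inv

/-- **Remark 2.4.2 — the incompatibility**: for `N = l^k` with `ζ(l) ≢ 1 (mod N)`, the isomorphism
`F_N(A) ⥲ F_N(A)` induced by the unit-wise Frobenius functor `Ψ_ζ` is NOT compatible with the natural
isomorphisms `F_N(A) ⥲ ℤ/Nℤ` (`InvariantIncompatible`, for every invariant datum).
[cite: MochizukiFrdII2008, Rmk 2.4.2 p.22] -/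
theorem invariantIncompatible_unitWiseFrobenius (l : Nat.Primes) (k : ℕ)
    (hζl : (((ζ l : ℕ+) : ℕ) : ZMod ((l : ℕ) ^ k)) ≠ 1) (inv : FNInvariant (ofChart c H hH) ((l : ℕ) ^ k)) :
    haveI := full_psiStrict hF τ hnorm hbt histr hup hpair ζ hζ
    haveI := faithful_psiStrict hF τ hnorm hbt histr hup hpair ζ hζ
    InvariantIncompatible (ofChart c H hH) (ofChart c H hH) ((l : ℕ) ^ k)
      ((isoOfFunctor (psiStrict hF τ hnorm hbt histr hup hpair ζ) c c
        (hO_psiStrict hF τ hnorm hbt histr hup hpair ζ) hker hker H hH H hH (ContinuousMulEquiv.refl _)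
        (houter_psiStrict hF τ hnorm hbt histr hup hpair ζ hζ c hker) (map_H_refl H) Iff.rfl).thm24Data
          ((l : ℕ) ^ k))
      inv inv :=
  Def22Context.Iso.invariantIncompatible_of_muIso_eq_pow _ _ _
    (isoE_isoOfFunctor_psiStrict hF τ hnorm hbt histr hup hpair ζ hζ c hker H hH)
    (muIso_isoOfFunctor_psiStrict hF τ hnorm hbt histr hup hpair ζ hζ c hker H hH l k) hζl inv

/-- **Remark 2.4.2, consequence for Theorem 2.4 (ii)** ("the natural isomorphisms `F_N(Aᵢ) ⥲ ℤ/Nℤ` are not,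
in general, compatible with the isomorphism `F_N(A₁) ⥲ F_N(A₂)` induced by `Ψ`"): for the comparison data
induced by `Ψ_ζ` the compatibility concluded by Theorem 2.4 (ii) FAILS, and `Thm24ii … fs fs …` forces
`¬ fs` (such a `Ψ` lives over a non-fieldwise-saturated `Φ`). [cite: MochizukiFrdII2008, Rmk 2.4.2 p.22] -/
theorem not_thm24ii_conclusion_unitWiseFrobenius (l : Nat.Primes) (k : ℕ)
    (hζl : (((ζ l : ℕ+) : ℕ) : ZMod ((l : ℕ) ^ k)) ≠ 1) (inv : FNInvariant (ofChart c H hH) ((l : ℕ) ^ k)) :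
    haveI := full_psiStrict hF τ hnorm hbt histr hup hpair ζ hζ
    haveI := faithful_psiStrict hF τ hnorm hbt histr hup hpair ζ hζ
    (¬ ∀ x : FN (ofChart c H hH) ((l : ℕ) ^ k),
      inv.toAddEquiv (((isoOfFunctor (psiStrict hF τ hnorm hbt histr hup hpair ζ) c c
        (hO_psiStrict hF τ hnorm hbt histr hup hpair ζ) hker hker H hH H hH (ContinuousMulEquiv.refl _)
        (houter_psiStrict hF τ hnorm hbt histr hup hpair ζ hζ c hker) (map_H_refl H) Iff.rfl).thm24Data
          ((l : ℕ) ^ k)).isoFN x) = inv.toAddEquiv x) ∧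
    ∀ fs : Prop, Thm24ii (ofChart c H hH) (ofChart c H hH) ((l : ℕ) ^ k) fs fs
      ((isoOfFunctor (psiStrict hF τ hnorm hbt histr hup hpair ζ) c c
        (hO_psiStrict hF τ hnorm hbt histr hup hpair ζ) hker hker H hH H hH (ContinuousMulEquiv.refl _)
        (houter_psiStrict hF τ hnorm hbt histr hup hpair ζ hζ c hker) (map_H_refl H) Iff.rfl).thm24Data
          ((l : ℕ) ^ k)) inv inv → ¬ fs := by
  have h := invariantIncompatible_unitWiseFrobenius hF τ hnorm hbt histr hup hpair ζ hζ c hker H hH l k hζl inv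
  exact ⟨not_thm24ii_conclusion_of_invariantIncompatible _ inv inv h,
    fun fs hii hfs => not_invariantIncompatible_of_thm24ii _ inv inv hii hfs hfs h⟩

end Rmk242

/-! ### Theorem 2.4 (i) holds for `Ψ_ζ` -/

section Thm24i

variable {D : Type} [SmallCategory D] {p : ℕ} [Fact p.Prime] {d : Datum D p}
  (hF : IsFrobenioid d.structureFunctor) (τ : CharacteristicSplitting d.structureFunctor)
  (hnorm : IsOfType (IsFrobeniusNormalized d.structureFunctor))
  (hbt : IsOfType (IsBaseTrivial d.structureFunctor)) (histr : IsOfIsotropicType d.structureFunctor)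
  (hup : IsOfUnitProfiniteType d.structureFunctor)
  {P : Presection d.frobenioid} {Fr : ℕ+ →* End P.ι} (hpair : IsBaseFrobeniusPair d.structureFunctor P Fr)
  (ζ : Nat.Primes → ℕ+) (hζ : IsOfCoprimeType ζ)
  {A : d.frobenioid} {K : Type} [Field K] [Algebra ℚ_[p] K] [FiniteDimensional ℚ_[p] K]
  {L : IntermediateField K (AlgebraicClosure K)} [Normal K L] [FiniteDimensional K L] (c : GaloisChart d A K L)
  (hker : ∀ α : Aut A, c.res α = 1 ↔ α.hom ∈ PreFrobenioid.endSubmonoid d.structureFunctor A)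
  (H : Subgroup (absoluteGaloisGroup K)) [H.Normal] (hH : IsOpen (H : Set (absoluteGaloisGroup K)))
  (N : ℕ) [NeZero N]
  (hμ : ∀ ξ : rootsOfUnity N (AlgebraicClosure K), ((ξ : (AlgebraicClosure K)ˣ) : AlgebraicClosure K) ∈ L)

/-- **Theorem 2.4 (i) HOLDS for the unit-wise Frobenius functor `Ψ_ζ`** (print: `Ψ_ζ` is an equivalence of
`p`-adic Frobenioids, so Theorem 2.4 (i) applies to it; only (ii)'s hypothesis — fieldwise saturation — can
fail): abc-iut-L1-t7's `thm24i_ofChart` for the context automorphism induced by `Ψ_ζ` (`hfs := Iff.rfl`, same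
object on both sides). [cite: MochizukiFrdII2008, Thm 2.4 (i) p.19] -/
theorem thm24i_unitWiseFrobenius (fs : Prop) (eFN : FN (ofChart c H hH) N ≃+ ZMod N)
    (hc : IsNHSaturated (ofChart c H hH) N) :
    haveI := full_psiStrict hF τ hnorm hbt histr hup hpair ζ hζ
    haveI := faithful_psiStrict hF τ hnorm hbt histr hup hpair ζ hζ
    haveI := locallyCompactSpace_H_ofChart (p₁ := p) c (H₁ := H) (hH₁ := hH)
    letI := c.galAction
    Thm24i (ofChart c H hH) (ofChart c H hH) N p p fs fs
      ((isoOfFunctor (psiStrict hF τ hnorm hbt histr hup hpair ζ) c c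
        (hO_psiStrict hF τ hnorm hbt histr hup hpair ζ) hker hker H hH H hH (ContinuousMulEquiv.refl _)
        (houter_psiStrict hF τ hnorm hbt histr hup hpair ζ hζ c hker) (map_H_refl H) Iff.rfl).thm24Data N)
      ((ofChart c H hH).dualityIsoOfLocalDuality N eFN hc
        (cupDualH_bijective_ofGalois_mlf p L H hH c.res c.res_smul (c.muModel N hμ)))
      ((ofChart c H hH).dualityIsoOfLocalDuality N
        (((isoOfFunctor (psiStrict hF τ hnorm hbt histr hup hpair ζ) c c
          (hO_psiStrict hF τ hnorm hbt histr hup hpair ζ) hker hker H hH H hH (ContinuousMulEquiv.refl _)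
          (houter_psiStrict hF τ hnorm hbt histr hup hpair ζ hζ c hker) (map_H_refl H) Iff.rfl).isoFN N).symm.trans
          eFN)
        (((isoOfFunctor (psiStrict hF τ hnorm hbt histr hup hpair ζ) c c
          (hO_psiStrict hF τ hnorm hbt histr hup hpair ζ) hker hker H hH H hH (ContinuousMulEquiv.refl _)
          (houter_psiStrict hF τ hnorm hbt histr hup hpair ζ hζ c hker) (map_H_refl H) Iff.rfl).isNHSaturated_iff
          N).mp hc)
        (cupDualH_bijective_ofGalois_mlf p L H hH c.res c.res_smul (c.muModel N hμ))) :=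
  haveI := full_psiStrict hF τ hnorm hbt histr hup hpair ζ hζ
  haveI := faithful_psiStrict hF τ hnorm hbt histr hup hpair ζ hζ
  haveI := locallyCompactSpace_H_ofChart (p₁ := p) c (H₁ := H) (hH₁ := hH)
  thm24i_ofChart c c _ N hμ hμ fs fs Iff.rfl eFN hc

end Thm24i

/-! ### The inputs for an absolutely primitive `p`-adic Frobenioid (Remark 1.2.1) -/

section Existence

variable {D : Type} [SmallCategory D] {p : ℕ} [Fact p.Prime] (d : Datum D p)

/-- `ζ₂ : l ↦ 2` for odd `l`, `2 ↦ 1`: a function of co-prime type (so `Ψ_{ζ₂}` is a self-equivalence) acting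
on `μ_l`, `l` odd, by squaring. [cite: MochizukiFrdI2008, Def. 2.8(iii) p.52] -/
theorem isOfCoprimeType_two : IsOfCoprimeType (fun l : Nat.Primes => if (l : ℕ) = 2 then 1 else 2) := by
  intro l
  by_cases h : (l : ℕ) = 2
  · simp only [h, if_true, PNat.one_coe]
    exact Nat.coprime_one_left _
  · simp only [h, if_false, PNat.val_ofNat]
    exact (Nat.coprime_primes Nat.prime_two l.2).mpr (Ne.symm h)

/-- For an odd prime `l`, `ζ₂(l) = 2 ≢ 1 (mod l)`: the incompatibility hypothesis of
`invariantIncompatible_unitWiseFrobenius` at `N = l`. [cite: MochizukiFrdII2008, Rmk 2.4.2 p.22] -/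
theorem zetaTwo_ne_one (l : Nat.Primes) (hl : (l : ℕ) ≠ 2) :
    ((((fun l : Nat.Primes => if (l : ℕ) = 2 then (1 : ℕ+) else 2) l : ℕ+) : ℕ) : ZMod ((l : ℕ) ^ 1)) ≠ 1 := by
  have h2 : (((fun l : Nat.Primes => if (l : ℕ) = 2 then (1 : ℕ+) else 2) l : ℕ+) : ℕ) = 2 := by
    show (((if (l : ℕ) = 2 then 1 else 2 : ℕ+)) : ℕ) = 2
    rw [if_neg hl]
    rfl
  rw [h2, pow_one]
  intro h
  have h' : ((2 : ℕ) : ZMod (l : ℕ)) = ((1 : ℕ) : ZMod (l : ℕ)) := by exact_mod_cast h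
  rw [ZMod.natCast_eq_natCast_iff, Nat.ModEq] at h'
  have hl2 : 2 < (l : ℕ) := lt_of_le_of_ne l.2.two_le (Ne.symm hl)
  rw [Nat.mod_eq_of_lt hl2, Nat.mod_eq_of_lt (lt_trans one_lt_two hl2)] at h'
  exact absurd h' (by decide)

/-- **The hypotheses of this file are inhabited by every `p`-adic Frobenioid with absolutely primitive `Φ`**
(and `Φ`, `B` monoids on `D`) — Remark 2.4.2's "when the `Φᵢ` are absolutely primitive [cf. Remark 1.2.1]":
the characteristic splitting `τ_p`, "`C` is a Frobenioid", Frobenius-normalized / base-trivial / isotropic /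
unit-profinite type and a base-Frobenius pair (pre-model type) are all theorems of the tree (abc-iut-L1-t4,
-d8, -d10, abc-iut-w4-d108, abc-iut-w5-d214's Remark 1.2.1 census), and `ζ₂` is of co-prime type with
`ζ₂(l) ≢ 1 (mod l)` for odd `l`. [cite: MochizukiFrdII2008, Rmk 2.4.2 p.22] -/
theorem rmk242_inputs_of_isAbsolutelyPrimitive (hmon : d.IsMonoidData) (hap : d.IsAbsolutelyPrimitive) :
    ∃ (_ : CharacteristicSplitting d.structureFunctor) (P : Presection d.frobenioid) (Fr : ℕ+ →* End P.ι)
      (ζ : Nat.Primes → ℕ+),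
      IsFrobenioid d.structureFunctor ∧ IsOfType (IsFrobeniusNormalized d.structureFunctor) ∧
      IsOfType (IsBaseTrivial d.structureFunctor) ∧ IsOfIsotropicType d.structureFunctor ∧
      IsOfUnitProfiniteType d.structureFunctor ∧ IsBaseFrobeniusPair d.structureFunctor P Fr ∧
      IsOfCoprimeType ζ ∧ ∀ l : Nat.Primes, (l : ℕ) ≠ 2 → (((ζ l : ℕ+) : ℕ) : ZMod ((l : ℕ) ^ 1)) ≠ 1 := by
  obtain ⟨P, Fr, hpair⟩ := d.thm12_isOfPreModelType'
  exact ⟨d.pSplitting hap, P, Fr, fun l => if (l : ℕ) = 2 then 1 else 2, d.isFrobenioid_of_isMonoidData hmon,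
    ModelFrobenioid.isOfType_isFrobeniusNormalized, d.thm12_isBaseTrivial_of_isAbsolutelyPrimitive hap,
    d.thm12_isOfIsotropicType, d.thm12_i_unitProfinite, hpair, isOfCoprimeType_two, zetaTwo_ne_one⟩

end Existence

end PadicFrd.Datum.GaloisChart

end Literature.AlgebraicGeometry.Frobenioids

end
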